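import Summits.ResolutionOfSingularities.ResolutionOfSingularities.Theorems.PurelyInseparableDim4ChartAtlasGlue
import Literature.AlgebraicGeometry.Resolution.BlowupDisjointCentreSplitting
import Literature.AlgebraicGeometry.Resolution.BlowupRestrictOpen
import Literature.AlgebraicGeometry.Resolution.BlowupsIntegral
import Literature.AlgebraicGeometry.Resolution.MonomialOrderReductionUnit
import Literature.AlgebraicGeometry.Resolution.BlowupSequencesBoundarySuperset
import HarnessLib

/-!
# Purely inseparable four-folds `z^p + F(x₁, …, x₄)`: ADMISSIBILITY OF A STRICT TRANSFORM AFTER ONE BLOW-UP ALONG A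
# DISCONNECTED CENTRE `V(C₁) ⊔ V(C₂)` FROM THE TWO ONE-PIECE REPAIRS (cell `res-dim4-pi`, typ-2 g7; HANDOFF OPEN 2, files F2/F3
# of memo S3-N2-SNC-CRITERION §11:20Z — the generic half)

[OURS · counted 0] (D-0157 DOOR 2; DR-157-C.) The far-resonance repair R1–R5 (p706678 … p709208) treats ONE resonant height by blowing
up `Σ′ ⊆ Zc`; two heights want ONE blow-up along the disjoint union `Σ′ ⊔ Σ″`, i.e. along the product `C₁·C₂` of two ideal sheaves
with disjoint supports (F1 p715277: `Σ′ ⊔ Σ″` is regular and snc with the boundary). This file is the GENERIC assembly, for any locally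
Noetherian scheme `X`, any `C₁, C₂` with disjoint supports, any ideal sheaf `Z` (the centre to be repaired), any boundary `E`, and ANY
blowing up `π : W → X` along `C₁·C₂`. PROVED here (no `sorry`, no new axiom):

* `strictTransformIdeal_comap_ι_preimage_centreCompl` / `comap_comap_ι_preimage_centreCompl_eq_top` — on the open piece
  `τ⁻¹(Y ∖ V(D))` of a blowing up `τ` along `D`, strict transforms are total transforms and the exceptional ideal is the unit ideal;
* `strictTransformIdeal_comp_comap_ι_preimage_centreCompl` / `comap_mul_comp_comap_ι_preimage_centreCompl` — for `π = τ₂ ≫ τ₁`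
  (`τ₁` along `C₁`, `τ₂` along `τ₁^*C₂`; Literature `IsBlowup.exists_comp_eq_of_mul`), on the piece `W₁ = π⁻¹(X ∖ V(C₂))`, which maps
  to `X₁` by the OPEN IMMERSION `g = ι ≫ τ₂` (Literature `IsBlowup.isOpenImmersion_preimage_compl_ι`): `St_π(K)|_{W₁} = g^* St_{τ₁}(K)`
  (Literature `IsBlowup.strictTransformIdeal_comp_of_disjoint`) and `π^*(C₁C₂)|_{W₁} = g^* τ₁^*C₁`;
* `hasSNCWith_strictTransform_comp_piece` — ONE PIECE: if `St_{τ₁}(Z)` is snc with `E₁.map St_{τ₁} ++ [τ₁^*C₁]` for a sub-boundary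
  `E₁` such that every member of `E` outside `E₁` meets `V(Z)` only inside `V(C₂)`, then on `W₁` the strict transform `St_π(Z)` is snc
  with the WHOLE transformed boundary `E.map St_π ++ [π^*(C₁C₂)]` (restriction along `g`, Literature `HasSNCWith.comap_of_isOpenImmersion`;
  the removed members miss the centre on the piece, Literature `HasSNCWith.of_disjoint`);
* **`hasSNCWith_transform_boundary_strictTransform_of_disjoint_repairs`** — GLUE (p692083 `hasSNCWith_of_cover_comap` over the two
  pieces, which cover `W` because `V(C₁) ∩ V(C₂) = ∅`): the two one-piece repair theorems (for EVERY blowing up along `C₁`, resp. `C₂`,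
  each with its own reduced boundary) give `HasSNCWith (E.map St_π ++ [π^*(C₁C₂)]) (St_π Z)`;
* `isRegular_strictTransform_of_disjoint_repairs`, `support_strictTransform_subset_of_disjoint_repairs` — the same glue for regularity
  (Literature `Scheme.IsRegular.subscheme_comap_of_isOpenImmersion`) and for `V(St_π Z) ⊆ supp(M.transform π (C₁C₂))` (Literature
  `IsBlowup.mem_support_transform_iff_of_not_mem`, `IsBlowup.transform_comp_of_disjoint_ideal`);
* **`admissible_strictTransform_of_disjoint_repairs`** — the three clauses of BGMW Def. 3.1.3 (1)(2) together.

The chart-model instance (two resonant far heights `c′ ≠ c″`: `C₁ = 𝓘(Σ′)`, `C₂ = ψ^*𝓘(Σ′)`, R4/R5 in both frames) is the companion file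
`…ChartAtlasSNCTwoHeights`. Nothing here is a statement about resolution of singularities in dimension ≥ 4 / characteristic `p` (NOT
proved anywhere in this programme). bears_on: LADDER-RESOLUTION:D157-DOOR2 (res-dim4-pi). Supports stmt-ResolutionOfSingularities-16155
(helper).
-/

-- every declaration of this summit lives under `Summit.ResolutionOfSingularities.ResolutionOfSingularities`
-- (summit = problem), which the duplicate-namespace linter flags; house convention (cf. the Target file).
set_option linter.dupNamespace false

noncomputable section

open CategoryTheory AlgebraicGeometry TopologicalSpace

namespace Summit.ResolutionOfSingularities.ResolutionOfSingularities.Theorems.PIDim4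

open Literature.AlgebraicGeometry.Resolution

namespace ChartDictionary

universe u

/-! ## §1 Off the centre of one blowing up -/

section OffCentre

variable {Y W : Scheme.{u}} {D : Y.IdealSheafData} {τ : W ⟶ Y}

/-- Membership in the support of a pull-back (Mathlib `support_comap`, pointwise). -/
theorem mem_support_comap_iff (f : W ⟶ Y) (K : Y.IdealSheafData) (w : W) :
    w ∈ (K.comap f).support ↔ f w ∈ K.support := by
  rw [Scheme.IdealSheafData.support_comap]
  rfl

/-- **OFF ITS CENTRE A BLOWING UP DOES NOT DISTINGUISH STRICT AND TOTAL TRANSFORMS**: on the open piece `τ⁻¹(Y ∖ V(D))` of `W` the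
strict transform of `V(K)` and the total transform `τ^*K` are the same ideal sheaf (stalkwise Literature
`IsBlowup.stalkIdeal_strictTransformIdeal_of_not_mem`; ideal sheaves are determined by their stalks). -/
theorem strictTransformIdeal_comap_ι_preimage_centreCompl [IsLocallyNoetherian Y] [IsLocallyNoetherian W] (hτ : IsBlowup τ D)
    (K : Y.IdealSheafData) :
    (strictTransformIdeal τ D K).comap (τ ⁻¹ᵁ centreCompl D).ι = (K.comap τ).comap (τ ⁻¹ᵁ centreCompl D).ι := by
  have h : ∀ u : ↥(τ ⁻¹ᵁ centreCompl D),
      stalkIdeal ((strictTransformIdeal τ D K).comap (τ ⁻¹ᵁ centreCompl D).ι) u =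
        stalkIdeal ((K.comap τ).comap (τ ⁻¹ᵁ centreCompl D).ι) u := fun u => by
    have hu : τ ((τ ⁻¹ᵁ centreCompl D).ι u) ∉ (D.support : Set Y) := u.2
    rw [stalkIdeal_comap_eq_map_stalkMap, stalkIdeal_comap_eq_map_stalkMap (τ ⁻¹ᵁ centreCompl D).ι (K.comap τ),
      hτ.stalkIdeal_strictTransformIdeal_of_not_mem K hu]
  exact le_antisymm (le_of_forall_stalkIdeal_le fun u => (h u).le) (le_of_forall_stalkIdeal_le fun u => (h u).ge)

/-- **… AND THE EXCEPTIONAL IDEAL IS THE UNIT IDEAL THERE**: `τ^*D` restricted to `τ⁻¹(Y ∖ V(D))` is `⊤` (its support is empty). -/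
theorem comap_comap_ι_preimage_centreCompl_eq_top (τ : W ⟶ Y) (D : Y.IdealSheafData) :
    (D.comap τ).comap (τ ⁻¹ᵁ centreCompl D).ι = ⊤ := by
  rw [← Scheme.IdealSheafData.support_eq_bot_iff, ← le_bot_iff]
  intro u hu
  rw [mem_support_comap_iff, mem_support_comap_iff] at hu
  have hu' : τ ((τ ⁻¹ᵁ centreCompl D).ι u) ∉ (D.support : Set Y) := u.2
  exact (hu' hu).elim

end OffCentre

/-! ## §2 The first open piece of a blowing up along `C₁·C₂` -/

section Piece

variable {X X₁ W : Scheme.{u}} {C₁ C₂ : X.IdealSheafData} {τ₁ : X₁ ⟶ X} {τ₂ : W ⟶ X₁}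

/-- **STRICT TRANSFORMS ALONG `π = τ₂ ≫ τ₁` ON THE PIECE `W₁ = π⁻¹(X ∖ V(C₂))`**: `St_π(K)|_{W₁} = g^* St_{τ₁}(K)` for the open immersion
`g = ι_{W₁} ≫ τ₂ : W₁ → X₁` (Literature `IsBlowup.strictTransformIdeal_comp_of_disjoint`: `St_π = St_{τ₂} ∘ St_{τ₁}`, and `St_{τ₂}` is a
total transform off the centre `τ₁^*C₂` of `τ₂`). -/
theorem strictTransformIdeal_comp_comap_ι_preimage_centreCompl [IsLocallyNoetherian X₁] [IsLocallyNoetherian W]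
    (hτ₂ : IsBlowup τ₂ (C₂.comap τ₁)) (hdisj : Disjoint (C₁.support : Set X) (C₂.support : Set X)) (K : X.IdealSheafData) :
    (strictTransformIdeal (τ₂ ≫ τ₁) (C₁ * C₂) K).comap (τ₂ ⁻¹ᵁ centreCompl (C₂.comap τ₁)).ι =
      (strictTransformIdeal τ₁ C₁ K).comap ((τ₂ ⁻¹ᵁ centreCompl (C₂.comap τ₁)).ι ≫ τ₂) := by
  rw [hτ₂.strictTransformIdeal_comp_of_disjoint hdisj K, strictTransformIdeal_comap_ι_preimage_centreCompl hτ₂,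
    Scheme.IdealSheafData.comap_comp]

/-- **THE EXCEPTIONAL IDEAL OF `π = τ₂ ≫ τ₁` ON THE PIECE `W₁`** is `g^* τ₁^*C₁` (the factor `π^*C₂` is the unit ideal there). -/
theorem comap_mul_comp_comap_ι_preimage_centreCompl (C₁ C₂ : X.IdealSheafData) (τ₁ : X₁ ⟶ X) (τ₂ : W ⟶ X₁) :
    ((C₁ * C₂).comap (τ₂ ≫ τ₁)).comap (τ₂ ⁻¹ᵁ centreCompl (C₂.comap τ₁)).ι =
      (C₁.comap τ₁).comap ((τ₂ ⁻¹ᵁ centreCompl (C₂.comap τ₁)).ι ≫ τ₂) := by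
  rw [comap_mul_comp, comap_mul, comap_comap_ι_preimage_centreCompl_eq_top, Scheme.IdealSheafData.mul_top,
    Scheme.IdealSheafData.comap_comp]

/-- **ONE PIECE.** `τ₁` a blowing up of `X` along `C₁`, `τ₂` a blowing up of `X₁` along `τ₁^*C₂`, `V(C₁) ∩ V(C₂) = ∅`, `π = τ₂ ≫ τ₁`
(a blowing up along `C₁·C₂`). If the transformed boundary `E.map St_π ++ [π^*(C₁C₂)]` is snc on `W`, the one-piece repair holds on `X₁`
for a sub-boundary `E₁` — `HasSNCWith (E₁.map St_{τ₁} ++ [τ₁^*C₁]) (St_{τ₁} Z)` — and every member of `E` outside `E₁` meets `V(Z)`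
only inside `V(C₂)`, then ON THE PIECE `W₁ = π⁻¹(X ∖ V(C₂))` the strict transform `St_π(Z)` is snc with the whole transformed boundary. -/
theorem hasSNCWith_strictTransform_comp_piece [IsLocallyNoetherian X] (hτ₁ : IsBlowup τ₁ C₁) (hτ₂ : IsBlowup τ₂ (C₂.comap τ₁))
    (hdisj : Disjoint (C₁.support : Set X) (C₂.support : Set X)) {Z : X.IdealSheafData} {E E₁ : List X.IdealSheafData}
    (hsnc : HasSNC (E.map (strictTransformIdeal (τ₂ ≫ τ₁) (C₁ * C₂)) ++ [(C₁ * C₂).comap (τ₂ ≫ τ₁)]))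
    (h₁ : HasSNCWith (E₁.map (strictTransformIdeal τ₁ C₁) ++ [C₁.comap τ₁]) (strictTransformIdeal τ₁ C₁ Z))
    (hd₁ : ∀ D ∈ E, D ∉ E₁ → (D.support : Set X) ∩ Z.support ⊆ C₂.support) :
    HasSNCWith
      ((E.map (strictTransformIdeal (τ₂ ≫ τ₁) (C₁ * C₂)) ++ [(C₁ * C₂).comap (τ₂ ≫ τ₁)]).map
        (·.comap (τ₂ ⁻¹ᵁ centreCompl (C₂.comap τ₁)).ι))
      ((strictTransformIdeal (τ₂ ≫ τ₁) (C₁ * C₂) Z).comap (τ₂ ⁻¹ᵁ centreCompl (C₂.comap τ₁)).ι) := by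
  classical
  haveI : IsLocallyNoetherian X₁ := hτ₁.isLocallyNoetherian
  haveI : IsLocallyNoetherian W := hτ₂.isLocallyNoetherian
  haveI : IsOpenImmersion ((τ₂ ⁻¹ᵁ centreCompl (C₂.comap τ₁)).ι ≫ τ₂) := hτ₂.isOpenImmersion_preimage_compl_ι
  rw [strictTransformIdeal_comp_comap_ι_preimage_centreCompl hτ₂ hdisj Z]
  refine HasSNCWith.of_disjoint
    (E' := (E₁.map (strictTransformIdeal τ₁ C₁) ++ [C₁.comap τ₁]).map (·.comap ((τ₂ ⁻¹ᵁ centreCompl (C₂.comap τ₁)).ι ≫ τ₂)))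
    (h₁.comap_of_isOpenImmersion ((τ₂ ⁻¹ᵁ centreCompl (C₂.comap τ₁)).ι ≫ τ₂)) ?_ ?_
  · -- the whole restricted boundary is snc
    have h := hsnc.comap_of_isOpenImmersion (τ₂ ⁻¹ᵁ centreCompl (C₂.comap τ₁)).ι
    rwa [Scheme.IdealSheafData.comap_top] at h
  · intro D' hD' hD'E'
    rw [List.map_append, List.mem_append, List.map_map, List.mem_map, List.map_singleton, List.mem_singleton] at hD'
    rcases hD' with ⟨D, hD, rfl⟩ | rfl
    · -- the strict transform of an old member
      simp only [Function.comp_apply] at hD'E' ⊢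
      rw [strictTransformIdeal_comp_comap_ι_preimage_centreCompl hτ₂ hdisj D] at hD'E' ⊢
      by_cases hDE₁ : D ∈ E₁
      · exact absurd (List.mem_map.mpr ⟨_, List.mem_append.mpr (Or.inl (List.mem_map.mpr ⟨D, hDE₁, rfl⟩)), rfl⟩) hD'E'
      · refine Set.eq_empty_iff_forall_notMem.mpr fun u hu => ?_
        have h1 : τ₁ (((τ₂ ⁻¹ᵁ centreCompl (C₂.comap τ₁)).ι ≫ τ₂) u) ∈ D.support :=
          mem_support_of_mem_support_strictTransformIdeal ((mem_support_comap_iff _ _ u).mp hu.1)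
        have h2 : τ₁ (((τ₂ ⁻¹ᵁ centreCompl (C₂.comap τ₁)).ι ≫ τ₂) u) ∈ Z.support :=
          mem_support_of_mem_support_strictTransformIdeal ((mem_support_comap_iff _ _ u).mp hu.2)
        have h3 := hd₁ D hD hDE₁ ⟨h1, h2⟩
        have hu' : τ₂ ((τ₂ ⁻¹ᵁ centreCompl (C₂.comap τ₁)).ι u) ∉ ((C₂.comap τ₁).support : Set X₁) := u.2
        rw [Scheme.Hom.comp_apply] at h3
        exact hu' ((mem_support_comap_iff τ₁ C₂ _).mpr h3)
    · -- the exceptional divisor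
      rw [comap_mul_comp_comap_ι_preimage_centreCompl] at hD'E'
      exact absurd (List.mem_map.mpr ⟨_, List.mem_append.mpr (Or.inr (List.mem_singleton.mpr rfl)), rfl⟩) hD'E'

/-- **ONE PIECE, REGULARITY**: `V(St_π Z)|_{W₁} = g⁻¹ V(St_{τ₁} Z)` is regular if `V(St_{τ₁} Z)` is. -/
theorem isRegular_strictTransform_comp_piece [IsLocallyNoetherian X] (hτ₁ : IsBlowup τ₁ C₁) (hτ₂ : IsBlowup τ₂ (C₂.comap τ₁))
    (hdisj : Disjoint (C₁.support : Set X) (C₂.support : Set X)) {Z : X.IdealSheafData}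
    (r₁ : Scheme.IsRegular (strictTransformIdeal τ₁ C₁ Z).subscheme) :
    Scheme.IsRegular ((strictTransformIdeal (τ₂ ≫ τ₁) (C₁ * C₂) Z).comap (τ₂ ⁻¹ᵁ centreCompl (C₂.comap τ₁)).ι).subscheme := by
  haveI : IsLocallyNoetherian X₁ := hτ₁.isLocallyNoetherian
  haveI : IsLocallyNoetherian W := hτ₂.isLocallyNoetherian
  haveI : IsOpenImmersion ((τ₂ ⁻¹ᵁ centreCompl (C₂.comap τ₁)).ι ≫ τ₂) := hτ₂.isOpenImmersion_preimage_compl_ι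
  rw [strictTransformIdeal_comp_comap_ι_preimage_centreCompl hτ₂ hdisj Z]
  exact r₁.subscheme_comap_of_isOpenImmersion _

/-- **ONE PIECE, SUPPORT**: `V(St_π Z) ∩ W₁ ⊆ supp(M.transform π (C₁C₂))` if `V(St_{τ₁} Z) ⊆ supp(M.transform τ₁ C₁)` (off the second
centre `τ₂` does not change supports, Literature `IsBlowup.mem_support_transform_iff_of_not_mem`; the one-step and two-step transforms
have the same ideal, Literature `IsBlowup.transform_comp_of_disjoint_ideal`). -/
theorem support_strictTransform_comp_piece [IsLocallyNoetherian X] (hτ₁ : IsBlowup τ₁ C₁) (hτ₂ : IsBlowup τ₂ (C₂.comap τ₁))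
    (hdisj : Disjoint (C₁.support : Set X) (C₂.support : Set X)) {Z : X.IdealSheafData} (M : MarkedIdeal X)
    (s₁ : ((strictTransformIdeal τ₁ C₁ Z).support : Set X₁) ⊆ (M.transform τ₁ C₁).support) :
    (((strictTransformIdeal (τ₂ ≫ τ₁) (C₁ * C₂) Z).comap (τ₂ ⁻¹ᵁ centreCompl (C₂.comap τ₁)).ι).support :
        Set ((τ₂ ⁻¹ᵁ centreCompl (C₂.comap τ₁) : W.Opens) : Scheme.{u})) ⊆
      (τ₂ ⁻¹ᵁ centreCompl (C₂.comap τ₁)).ι ⁻¹' (M.transform (τ₂ ≫ τ₁) (C₁ * C₂)).support := by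
  haveI : IsLocallyNoetherian X₁ := hτ₁.isLocallyNoetherian
  haveI : IsLocallyNoetherian W := hτ₂.isLocallyNoetherian
  intro u hu
  rw [strictTransformIdeal_comp_comap_ι_preimage_centreCompl hτ₂ hdisj Z] at hu
  replace hu := (mem_support_comap_iff _ _ u).mp hu
  rw [Scheme.Hom.comp_apply] at hu
  have hu' : τ₂ ((τ₂ ⁻¹ᵁ centreCompl (C₂.comap τ₁)).ι u) ∉ ((C₂.comap τ₁).support : Set X₁) := u.2
  have key : (τ₂ ⁻¹ᵁ centreCompl (C₂.comap τ₁)).ι u ∈ ((M.transform τ₁ C₁).transform τ₂ (C₂.comap τ₁)).support :=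
    (hτ₂.mem_support_transform_iff_of_not_mem (M.transform τ₁ C₁) hu').mpr (s₁ hu)
  show (((M.transform (τ₂ ≫ τ₁) (C₁ * C₂)).mult : ℕ) : ℕ∞) ≤ idealOrder (M.transform (τ₂ ≫ τ₁) (C₁ * C₂)).ideal _
  rw [hτ₁.transform_comp_of_disjoint_ideal hτ₂ hdisj M]
  exact key

end Piece

/-! ## §3 Glue over the two pieces -/

section Glue

variable {X : Scheme.{u}} [IsLocallyNoetherian X] {C₁ C₂ Z : X.IdealSheafData} {W : Scheme.{u}} {π : W ⟶ X}

omit [IsLocallyNoetherian X] in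
/-- The two pieces `π⁻¹(X ∖ V(C₂))`, `π⁻¹(X ∖ V(C₁))` cover `W` when `V(C₁) ∩ V(C₂) = ∅`. -/
theorem mem_iUnion_range_ι_pieces (hdisj : Disjoint (C₁.support : Set X) (C₂.support : Set X))
    {X₁ X₂ : Scheme.{u}} {τ₁ : X₁ ⟶ X} {τ₂ : W ⟶ X₁} {σ₁ : X₂ ⟶ X} {σ₂ : W ⟶ X₂} (hfac : τ₂ ≫ τ₁ = π) (hfac' : σ₂ ≫ σ₁ = π)
    (w : W) :
    w ∈ ⋃ b : Bool, Set.range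
      ((bif b then τ₂ ⁻¹ᵁ centreCompl (C₂.comap τ₁) else σ₂ ⁻¹ᵁ centreCompl (C₁.comap σ₁)) : W.Opens).ι := by
  by_cases hw : π w ∈ (C₂.support : Set X)
  · have hw1 : π w ∉ (C₁.support : Set X) := fun h => hdisj.le_bot ⟨h, hw⟩
    refine Set.mem_iUnion.mpr ⟨false, ?_⟩
    rw [Scheme.Opens.range_ι]
    show σ₂ w ∉ ((C₁.comap σ₁).support : Set X₂)
    rw [SetLike.mem_coe, mem_support_comap_iff, ← Scheme.Hom.comp_apply, hfac']
    exact hw1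
  · refine Set.mem_iUnion.mpr ⟨true, ?_⟩
    rw [Scheme.Opens.range_ι]
    show τ₂ w ∉ ((C₂.comap τ₁).support : Set X₁)
    rw [SetLike.mem_coe, mem_support_comap_iff, ← Scheme.Hom.comp_apply, hfac]
    exact hw

/-- **GLUE — SIMPLE NORMAL CROSSINGS OF THE STRICT TRANSFORM AFTER ONE BLOW-UP ALONG `C₁·C₂` FROM THE TWO ONE-PIECE REPAIRS.**
`V(C₁) ∩ V(C₂) = ∅`, `E` snc with `C₁·C₂`; for EVERY blowing up along `C₁` the repair holds with the sub-boundary `E₁` whose complement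
in `E` meets `V(Z)` only inside `V(C₂)`, and symmetrically for `C₂`, `E₂`, `V(C₁)`. Then for every blowing up `π` along `C₁·C₂`:
`HasSNCWith (E.map St_π ++ [π^*(C₁C₂)]) (St_π Z)`. -/
theorem hasSNCWith_transform_boundary_strictTransform_of_disjoint_repairs
    (hdisj : Disjoint (C₁.support : Set X) (C₂.support : Set X)) {E E₁ E₂ : List X.IdealSheafData}
    (h12 : HasSNCWith E (C₁ * C₂))
    (h₁ : ∀ ⦃X₁ : Scheme.{u}⦄ ⦃τ : X₁ ⟶ X⦄, IsBlowup τ C₁ →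
      HasSNCWith (E₁.map (strictTransformIdeal τ C₁) ++ [C₁.comap τ]) (strictTransformIdeal τ C₁ Z))
    (hd₁ : ∀ D ∈ E, D ∉ E₁ → (D.support : Set X) ∩ Z.support ⊆ C₂.support)
    (h₂ : ∀ ⦃X₂ : Scheme.{u}⦄ ⦃τ : X₂ ⟶ X⦄, IsBlowup τ C₂ →
      HasSNCWith (E₂.map (strictTransformIdeal τ C₂) ++ [C₂.comap τ]) (strictTransformIdeal τ C₂ Z))
    (hd₂ : ∀ D ∈ E, D ∉ E₂ → (D.support : Set X) ∩ Z.support ⊆ C₁.support) (hπ : IsBlowup π (C₁ * C₂)) :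
    HasSNCWith (E.map (strictTransformIdeal π (C₁ * C₂)) ++ [(C₁ * C₂).comap π]) (strictTransformIdeal π (C₁ * C₂) Z) := by
  obtain ⟨X₁, τ₁, τ₂, hτ₁, hτ₂, hfac⟩ := hπ.exists_comp_eq_of_mul
  obtain ⟨X₂, σ₁, σ₂, hσ₁, hσ₂, hfac'⟩ := hπ.exists_comp_eq_of_mul'
  have hsncW : HasSNC (E.map (strictTransformIdeal π (C₁ * C₂)) ++ [(C₁ * C₂).comap π]) := h12.hasSNC_transform hπ
  refine hasSNCWith_of_cover_comap
    (fun b : Bool => ((bif b then τ₂ ⁻¹ᵁ centreCompl (C₂.comap τ₁) else σ₂ ⁻¹ᵁ centreCompl (C₁.comap σ₁)) : W.Opens).ι)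
    hsncW (fun w _ => mem_iUnion_range_ι_pieces hdisj hfac hfac' w) ?_
  rintro (_ | _)
  · -- over `X ∖ V(C₁)`: the factorisation through the blowing up along `C₂` first
    show HasSNCWith (List.map (fun D : W.IdealSheafData => D.comap (σ₂ ⁻¹ᵁ centreCompl (C₁.comap σ₁)).ι) _)
      ((strictTransformIdeal π (C₁ * C₂) Z).comap (σ₂ ⁻¹ᵁ centreCompl (C₁.comap σ₁)).ι)
    have hsnc' : HasSNC (E.map (strictTransformIdeal (σ₂ ≫ σ₁) (C₂ * C₁)) ++ [(C₂ * C₁).comap (σ₂ ≫ σ₁)]) := by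
      rw [hfac', mul_comm C₂ C₁]; exact hsncW
    rw [← hfac', mul_comm C₁ C₂]
    exact hasSNCWith_strictTransform_comp_piece hσ₁ hσ₂ hdisj.symm hsnc' (h₂ hσ₁) hd₂
  · -- over `X ∖ V(C₂)`: the factorisation through the blowing up along `C₁` first
    show HasSNCWith (List.map (fun D : W.IdealSheafData => D.comap (τ₂ ⁻¹ᵁ centreCompl (C₂.comap τ₁)).ι) _)
      ((strictTransformIdeal π (C₁ * C₂) Z).comap (τ₂ ⁻¹ᵁ centreCompl (C₂.comap τ₁)).ι)
    have hsnc' : HasSNC (E.map (strictTransformIdeal (τ₂ ≫ τ₁) (C₁ * C₂)) ++ [(C₁ * C₂).comap (τ₂ ≫ τ₁)]) := by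
      rw [hfac]; exact hsncW
    rw [← hfac]
    exact hasSNCWith_strictTransform_comp_piece hτ₁ hτ₂ hdisj hsnc' (h₁ hτ₁) hd₁

/-- **GLUE — REGULARITY**: `V(St_π Z)` is regular if `V(St_τ Z)` is regular for every blowing up `τ` along `C₁` and along `C₂`. -/
theorem isRegular_strictTransform_of_disjoint_repairs (hdisj : Disjoint (C₁.support : Set X) (C₂.support : Set X))
    (r₁ : ∀ ⦃X₁ : Scheme.{u}⦄ ⦃τ : X₁ ⟶ X⦄, IsBlowup τ C₁ → Scheme.IsRegular (strictTransformIdeal τ C₁ Z).subscheme)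
    (r₂ : ∀ ⦃X₂ : Scheme.{u}⦄ ⦃τ : X₂ ⟶ X⦄, IsBlowup τ C₂ → Scheme.IsRegular (strictTransformIdeal τ C₂ Z).subscheme)
    (hπ : IsBlowup π (C₁ * C₂)) : Scheme.IsRegular (strictTransformIdeal π (C₁ * C₂) Z).subscheme := by
  obtain ⟨X₁, τ₁, τ₂, hτ₁, hτ₂, hfac⟩ := hπ.exists_comp_eq_of_mul
  obtain ⟨X₂, σ₁, σ₂, hσ₁, hσ₂, hfac'⟩ := hπ.exists_comp_eq_of_mul'
  refine isRegular_subscheme_of_cover_comap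
    (fun b : Bool => ((bif b then τ₂ ⁻¹ᵁ centreCompl (C₂.comap τ₁) else σ₂ ⁻¹ᵁ centreCompl (C₁.comap σ₁)) : W.Opens).ι)
    (fun w _ => mem_iUnion_range_ι_pieces hdisj hfac hfac' w) ?_
  rintro (_ | _)
  · show Scheme.IsRegular ((strictTransformIdeal π (C₁ * C₂) Z).comap (σ₂ ⁻¹ᵁ centreCompl (C₁.comap σ₁)).ι).subscheme
    rw [← hfac', mul_comm C₁ C₂]
    exact isRegular_strictTransform_comp_piece hσ₁ hσ₂ hdisj.symm (r₂ hσ₁)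
  · show Scheme.IsRegular ((strictTransformIdeal π (C₁ * C₂) Z).comap (τ₂ ⁻¹ᵁ centreCompl (C₂.comap τ₁)).ι).subscheme
    rw [← hfac]
    exact isRegular_strictTransform_comp_piece hτ₁ hτ₂ hdisj (r₁ hτ₁)

/-- **GLUE — SUPPORT**: `V(St_π Z) ⊆ supp(M.transform π (C₁C₂))` if `V(St_τ Z) ⊆ supp(M.transform τ Cᵢ)` for every blowing up `τ`
along `C₁` and along `C₂`. -/
theorem support_strictTransform_subset_of_disjoint_repairs (hdisj : Disjoint (C₁.support : Set X) (C₂.support : Set X))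
    (M : MarkedIdeal X)
    (s₁ : ∀ ⦃X₁ : Scheme.{u}⦄ ⦃τ : X₁ ⟶ X⦄, IsBlowup τ C₁ →
      ((strictTransformIdeal τ C₁ Z).support : Set X₁) ⊆ (M.transform τ C₁).support)
    (s₂ : ∀ ⦃X₂ : Scheme.{u}⦄ ⦃τ : X₂ ⟶ X⦄, IsBlowup τ C₂ →
      ((strictTransformIdeal τ C₂ Z).support : Set X₂) ⊆ (M.transform τ C₂).support)
    (hπ : IsBlowup π (C₁ * C₂)) :
    ((strictTransformIdeal π (C₁ * C₂) Z).support : Set W) ⊆ (M.transform π (C₁ * C₂)).support := by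
  obtain ⟨X₁, τ₁, τ₂, hτ₁, hτ₂, hfac⟩ := hπ.exists_comp_eq_of_mul
  obtain ⟨X₂, σ₁, σ₂, hσ₁, hσ₂, hfac'⟩ := hπ.exists_comp_eq_of_mul'
  refine support_subset_of_cover_comap
    (fun b : Bool => ((bif b then τ₂ ⁻¹ᵁ centreCompl (C₂.comap τ₁) else σ₂ ⁻¹ᵁ centreCompl (C₁.comap σ₁)) : W.Opens).ι)
    (fun w _ => mem_iUnion_range_ι_pieces hdisj hfac hfac' w) ?_
  rintro (_ | _)
  · show (((strictTransformIdeal π (C₁ * C₂) Z).comap (σ₂ ⁻¹ᵁ centreCompl (C₁.comap σ₁)).ι).support : Set _) ⊆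
      (σ₂ ⁻¹ᵁ centreCompl (C₁.comap σ₁)).ι ⁻¹' (M.transform π (C₁ * C₂)).support
    rw [← hfac', mul_comm C₁ C₂]
    exact support_strictTransform_comp_piece hσ₁ hσ₂ hdisj.symm M (s₂ hσ₁)
  · show (((strictTransformIdeal π (C₁ * C₂) Z).comap (τ₂ ⁻¹ᵁ centreCompl (C₂.comap τ₁)).ι).support : Set _) ⊆
      (τ₂ ⁻¹ᵁ centreCompl (C₂.comap τ₁)).ι ⁻¹' (M.transform π (C₁ * C₂)).support
    rw [← hfac]
    exact support_strictTransform_comp_piece hτ₁ hτ₂ hdisj M (s₁ hτ₁)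

/-- **ADMISSIBILITY OF THE STRICT TRANSFORM AFTER ONE BLOW-UP ALONG A DISCONNECTED CENTRE FROM THE TWO ONE-PIECE REPAIRS.** For the
marked ideal `M = (X, 𝓘, E, μ)` whose boundary is snc with `C₁·C₂`, and a centre `Z`: if for every blowing up `τ` along `C₁` the strict
transform `St_τ(Z)` is regular, inside `supp(M.transform τ C₁)`, and snc with `E₁.map St_τ ++ [τ^*C₁]` for a sub-boundary `E₁` whose
complement meets `V(Z)` only inside `V(C₂)` — and symmetrically for `C₂` — then for every blowing up `π` along `C₁·C₂` the strict
transform `C' = St_π(Z)` is an ADMISSIBLE centre for `M' = M.transform π (C₁C₂)` (BGMW Def. 3.1.3 (1)(2): regular, `V(C') ⊆ supp M'`,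
`HasSNCWith M'.boundary C'`). -/
theorem admissible_strictTransform_of_disjoint_repairs (hdisj : Disjoint (C₁.support : Set X) (C₂.support : Set X))
    (M : MarkedIdeal X) {E₁ E₂ : List X.IdealSheafData} (h12 : HasSNCWith M.boundary (C₁ * C₂))
    (a₁ : ∀ ⦃X₁ : Scheme.{u}⦄ ⦃τ : X₁ ⟶ X⦄, IsBlowup τ C₁ →
      Scheme.IsRegular (strictTransformIdeal τ C₁ Z).subscheme ∧
        ((strictTransformIdeal τ C₁ Z).support : Set X₁) ⊆ (M.transform τ C₁).support ∧
        HasSNCWith (E₁.map (strictTransformIdeal τ C₁) ++ [C₁.comap τ]) (strictTransformIdeal τ C₁ Z))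
    (hd₁ : ∀ D ∈ M.boundary, D ∉ E₁ → (D.support : Set X) ∩ Z.support ⊆ C₂.support)
    (a₂ : ∀ ⦃X₂ : Scheme.{u}⦄ ⦃τ : X₂ ⟶ X⦄, IsBlowup τ C₂ →
      Scheme.IsRegular (strictTransformIdeal τ C₂ Z).subscheme ∧
        ((strictTransformIdeal τ C₂ Z).support : Set X₂) ⊆ (M.transform τ C₂).support ∧
        HasSNCWith (E₂.map (strictTransformIdeal τ C₂) ++ [C₂.comap τ]) (strictTransformIdeal τ C₂ Z))
    (hd₂ : ∀ D ∈ M.boundary, D ∉ E₂ → (D.support : Set X) ∩ Z.support ⊆ C₁.support) (hπ : IsBlowup π (C₁ * C₂)) :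
    let M' := M.transform π (C₁ * C₂)
    let C' := strictTransformIdeal π (C₁ * C₂) Z
    Scheme.IsRegular C'.subscheme ∧ (C'.support : Set W) ⊆ M'.support ∧ HasSNCWith M'.boundary C' := by
  refine ⟨isRegular_strictTransform_of_disjoint_repairs hdisj (fun _ _ h => (a₁ h).1) (fun _ _ h => (a₂ h).1) hπ,
    support_strictTransform_subset_of_disjoint_repairs hdisj M (fun _ _ h => (a₁ h).2.1) (fun _ _ h => (a₂ h).2.1) hπ, ?_⟩
  rw [MarkedIdeal.transform_boundary]
  exact hasSNCWith_transform_boundary_strictTransform_of_disjoint_repairs hdisj h12 (fun _ _ h => (a₁ h).2.2) hd₁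
    (fun _ _ h => (a₂ h).2.2) hd₂ hπ

end Glue

end ChartDictionary

end Summit.ResolutionOfSingularities.ResolutionOfSingularities.Theorems.PIDim4

end
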